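import Summits.ABC.IUTFork.LanaLocalUnits
import HarnessLib

/-!
# L-LANA objects VI: the mono-analytic log-shells `(MF)`, `(ME)` as "`(2p_v)⁻¹ · I^κ`" (LANA §5.1 (c), (d))

Record-only file (D-0012) of the abc-iut cell (seat abc-iut-c312-4, L-LANA level, plan/LLANA-SPEC N10,
mono-analytic half only); TAKES NO SIDE on [IUTchIII] Cor. 3.12. Project LANA's interim report (bib
`LANA2026Report`, read on the page), §5.1 p. 26: "the `p`-adic logarithm map gives an isomorphism of groups
`log : O^{×μ}_v ⥲ K̄_v`" [onto its image; kernel = torsion], and §5.1 (c) p. 27: "The group `O^{×μ}_v` is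
isomorphic to the underlying additive group of the field `K̄_v`. The mono-analytic Frobenius-like log-shell
at `v` is a `ℤ_{p_v}`-submodule of `O^{×μ}_v` defined as `I_v(F^{⊢×μ}) = (2p_v)⁻¹ · Im(I^κ_{G_v} ↪ O^{×μ}_v)`."
§5.1 (d) p. 27: "One can construct via an anabelian algorithm an étale-like version `O^{×μ}_v(G_v)` of
`O^{×μ}_v` together with a compact structure `{I^κ_H(G_v)}_H`. The mono-analytic étale-like log-shell at `v` is
… `I_v(D^⊢) = (2p_v)⁻¹ · Im(I^κ_{G_v}(G_v) ↪ O^{×μ}_v(G_v))`."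

What is typed. INSIDE the multiplicative group `O^{×μ}` (torsion-free by construction) "`(2p_v)⁻¹ · X`" is
the set of `(2p_v)`-th ROOTS of elements of `X` — this needs no logarithm and no ring structure, which is the
point of the mono-analytic versions ("containers … in situations where a complete ring-theoretic structure
does not exist", §5.1 (e) p. 28). So: `rootSet n X := {y | y^n ∈ X}` (a subgroup when `X` is), the `(MF)`
log-shell `logShellMF := rootSet (2p_v) I^κ_{G_v}` over the data of `LanaLocalUnits.lean`, and — for ANY
abstract datum `(G ↷ M, {N_H})` (the étale-like version `O^{×μ}_v(G_v)` being one, once reconstructed: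
LLANA-SPEC N9, seat abc-iut-L4-t1) — `logShellOf M N n := {y ∈ M | y^n ∈ N}`. PROVED bookkeeping:
`kummer_le_logShellMF` (`I^κ_{G_v} ⊆ I_v`), functoriality of root sets under homomorphisms
(`rootSet_map_le`: an isomorphism respecting `I^κ` respects the log-shells — why the `(ME)` shell "can
transcend the walls of log-links", Rem. 5.3.1 p. 30, at this level), `logShellMF_G_stable`.

Modelling notes. (i) The factor "(2p_v)⁻¹" presupposes unique divisibility of `O^{×μ}_v ≅ (K̄_v, +)`; in a
group that is merely torsion-free, `rootSet n X ⊇ X` is the honest rendering of `n⁻¹·X` (equal to it when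
`n`-th roots exist). (ii) The HOLOMORPHIC versions `(HF)`/`(HE)` (§5.1 (a),(b): "new multiplication" making
`O^{×μ}(F)` a field, [AbsTopIII] Prop. 3.2) need the `p`-adic logarithm and reconstruction — seats abc-iut-S1 /
L4-t2; the inclusion "`O_v ⊂ I_v`" (p. 26) is a statement about `log` and is NOT available at this level.
NOT here: volume containers, log-links, any judgement.
-/

namespace Summit.ABC
namespace IUTFork

/-! ## 1. `n⁻¹ · X` inside a commutative group: the set of `n`-th roots of `X` -/

section Roots

variable {M : Type} [CommGroup M]

/-- `n⁻¹ · X := {y | yⁿ ∈ X}` for a subgroup `X` of a commutative group (written multiplicatively): the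
subgroup of `n`-th roots of elements of `X` (modelling note (i)). [cite: LANA2026Report, §5.1 (c) p. 27] -/
def rootSet (n : ℕ) (X : Subgroup M) : Subgroup M where
  carrier := {y | y ^ n ∈ X}
  one_mem' := by simp [X.one_mem]
  mul_mem' := by
    intro a b ha hb
    simp only [Set.mem_setOf_eq, mul_pow] at *
    exact X.mul_mem ha hb
  inv_mem' := by
    intro a ha
    simp only [Set.mem_setOf_eq, inv_pow] at *
    exact X.inv_mem ha

/-- Membership in `n⁻¹ · X`. [cite: LANA2026Report, §5.1 (c) p. 27] -/
@[simp] theorem mem_rootSet_iff (n : ℕ) (X : Subgroup M) (y : M) : y ∈ rootSet n X ↔ y ^ n ∈ X := Iff.rfl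

/-- `X ⊆ n⁻¹ · X`. [folklore] -/
theorem le_rootSet (n : ℕ) (X : Subgroup M) : X ≤ rootSet n X := fun _ hy => X.pow_mem hy n

/-- `n⁻¹ · X` is monotone in `X`. [folklore] -/
theorem rootSet_mono (n : ℕ) {X X' : Subgroup M} (h : X ≤ X') : rootSet n X ≤ rootSet n X' :=
  fun _ hy => h hy

/-- Functoriality: a homomorphism carrying `X` into `X′` carries `n⁻¹·X` into `n⁻¹·X′`. [folklore] -/
theorem rootSet_map_le {M' : Type} [CommGroup M'] (f : M →* M') (n : ℕ) (X : Subgroup M)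
    (X' : Subgroup M') (h : X.map f ≤ X') : (rootSet n X).map f ≤ rootSet n X' := by
  rintro _ ⟨y, hy, rfl⟩
  rw [SetLike.mem_coe, mem_rootSet_iff] at hy
  rw [mem_rootSet_iff, ← map_pow]
  exact h ⟨y ^ n, hy, rfl⟩

/-- In particular an isomorphism matching `X` with `X′` matches `n⁻¹·X` with `n⁻¹·X′` (an isomorphism of
étale-unit data respecting compact structures respects the log-shells built from them).
[cite: LANA2026Report, Rem. 5.3.1 p. 30] -/
theorem rootSet_map_equiv {M' : Type} [CommGroup M'] (e : M ≃* M') (n : ℕ) (X : Subgroup M)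
    (X' : Subgroup M') (h : X.map (e : M →* M') = X') : (rootSet n X).map (e : M →* M') = rootSet n X' := by
  refine le_antisymm (rootSet_map_le _ n X X' h.le) ?_
  intro y hy
  rw [mem_rootSet_iff, ← h] at hy
  obtain ⟨x, hx, hxy⟩ := hy
  refine ⟨e.symm y, ?_, by simp⟩
  rw [SetLike.mem_coe, mem_rootSet_iff]
  have : x = (e.symm y) ^ n := by
    apply e.injective
    rw [map_pow]
    change (e : M →* M') x = y ^ n at hxy
    rw [MonoidHom.coe_coe] at hxy
    rw [hxy, MulEquiv.apply_symm_apply]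
  rwa [← this]

end Roots

/-! ## 2. The `(MF)` log-shell of the reference datum and the `(ME)`-shape over abstract data -/

section MF

variable {K : Type} [Field K] {Γ₀ : Type} [LinearOrderedCommGroupWithZero Γ₀] (w : Valuation K Γ₀)
  (G : Type) [Group G] [MulSemiringAction G K] [IsValPreserving w G]

/-- **§5.1 (c) (MF)**: "The mono-analytic Frobenius-like log-shell at `v` is … `I_v(F^{⊢×μ}) = (2p_v)⁻¹ ·
Im(I^κ_{G_v} ↪ O^{×μ}_v)`" — inside `O^{×μ}` (multiplicatively): the `(2p_v)`-th roots of the top member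
`I^κ_{G_v}` of the compact structure; `p` is the residue characteristic `p_v`.
[cite: LANA2026Report, §5.1 (c) p. 27] -/
def logShellMF (p : ℕ) : Subgroup (UnitsModTorsion w) := rootSet (2 * p) (kummerStructure w G ⊤)

/-- Membership in the `(MF)` log-shell. [cite: LANA2026Report, §5.1 (c) p. 27] -/
theorem mem_logShellMF_iff (p : ℕ) (y : UnitsModTorsion w) :
    y ∈ logShellMF w G p ↔ y ^ (2 * p) ∈ kummerStructure w G ⊤ := Iff.rfl

/-- `I^κ_{G_v} ⊆ I_v(F^{⊢×μ})` (the image of the invariant units lies in the log-shell).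
[cite: LANA2026Report, §5.1 (c) p. 27] -/
theorem kummer_le_logShellMF (p : ℕ) : kummerStructure w G ⊤ ≤ logShellMF w G p := le_rootSet _ _

/-- The `(MF)` log-shell is `G_v`-stable: `g · I_v = I_v` elementwise (`I^κ_{G_v}` consists of classes of
`G_v`-INVARIANT units, on which `G_v` acts trivially, and `g·(yⁿ) = (g·y)ⁿ`). [cite: LANA2026Report, §5.1 (c) p. 27] -/
theorem logShellMF_G_stable (p : ℕ) (g : G) {y : UnitsModTorsion w} (hy : y ∈ logShellMF w G p) :
    g • y ∈ logShellMF w G p := by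
  rw [mem_logShellMF_iff] at *
  rw [← smul_pow']
  obtain ⟨u, hu, hux⟩ := (mem_kummerStructure_iff w G ⊤ _).mp hy
  refine (mem_kummerStructure_iff w G ⊤ _).mpr ⟨u, hu, ?_⟩
  rw [← hux, UnitsModTorsion.smul_mk]
  congr 1
  exact ((mem_unitInvariants_iff w G ⊤ u).mp hu ⟨g, trivial⟩).symm

end MF

section ME

variable {M : Type} [CommGroup M]

/-- **§5.1 (d) (ME)-shape**: for ANY abstract datum "`O^{×μ}_v(G_v)` together with a compact structure
`{I^κ_H(G_v)}_H`" (a commutative group `M` with a distinguished subgroup `N = I^κ_{G_v}(G_v)`; its anabelian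
construction from `G_v` is LLANA-SPEC N9), "`I_v(D^⊢) = (2p_v)⁻¹ · Im(I^κ_{G_v}(G_v) ↪ O^{×μ}_v(G_v))`".
[cite: LANA2026Report, §5.1 (d) p. 27] -/
def logShellOf (N : Subgroup M) (p : ℕ) : Subgroup M := rootSet (2 * p) N

/-- The `(MF)` log-shell is the `(ME)`-shape applied to the Frobenius-like datum `(O^{×μ}, I^κ_{G_v})`.
[cite: LANA2026Report, §5.1 (c),(d) p. 27] -/
theorem logShellMF_eq_logShellOf {K : Type} [Field K] {Γ₀ : Type} [LinearOrderedCommGroupWithZero Γ₀]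
    (w : Valuation K Γ₀) (G : Type) [Group G] [MulSemiringAction G K] [IsValPreserving w G] (p : ℕ) :
    logShellMF w G p = logShellOf (kummerStructure w G ⊤) p := rfl

/-- **Rem. 5.3.1 p. 30 at this level**: an isomorphism `M ⥲ M′` matching the distinguished subgroups
matches the log-shells — "Since the étale-like log-shells … are constructed only from the étale-like portion
… they can transcend the walls of log-links and be shared". [cite: LANA2026Report, Rem. 5.3.1 p. 30] -/
theorem logShellOf_map_equiv {M' : Type} [CommGroup M'] (e : M ≃* M') (N : Subgroup M) (N' : Subgroup M')
    (h : N.map (e : M →* M') = N') (p : ℕ) :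
    (logShellOf N p).map (e : M →* M') = logShellOf N' p :=
  rootSet_map_equiv e _ N N' h

end ME

end IUTFork

end Summit.ABC
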